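import Summits.CriticalPhenomena.PercolationContinuityZ3.Theorems.PercNearOneGluingNoHeavyLowerTailSunflowerSpectatorRows
import HarnessLib

/-!
# `NoHeavyLowerTail` (crux stmt-CriticalPhenomena-4575), abstract sunflower cubic: the kernel- and bottom-spectator slacks `SA`, `SB`,
# the decomposition `ZH = 3(SA + SB) − Ntri`, and the census-true DICHOTOMY `PurePayer` ("the larger Gladkov slack alone pays for the rainbows")

Support file (seat `prim-ineq-prove-1` gen 29; `--supports stmt-CriticalPhenomena-4575`).  Nothing is asserted about the crux; no `sorry`.
Memo: run/shared/lean/prim/prim-ineq-prove-1/FINDING-PAYER-prove1-g29.md.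

For a sunflower of up-sets `F` (monotone map `2^α → M₃`) write, over ordered 3-partitions `(P¹,P²,P³)`,
`SA := Σ_{lab P¹ = ⊤} kk (lab P²) (lab P³)` (antipodal-Gladkov surplus seen by KERNEL spectators, `= ZA / 3`) and
`SB := Σ_{lab P¹ = 0} kk (lab P²) (lab P³)` (BOTTOM spectators).  Both are `≥ 0` (`Sw_nonneg`) and the partition functional of the
`H`-row splits as `ZH = 3·(SA + SB) − Ntri` (`ZH_eq_SA_SB`; `Ntri` = number of ordered rainbow partitions), so that the partition lemma
`PartitionLemmaH` reads `3(SA + SB) ≥ Ntri`, g25's `PartitionLemmaB` (refuted on the doubled star, `…SunflowerPartitionLemmaBRefutation`) reads `3·SB ≥ Ntri` (`ZB = 3·SB − Ntri`), and its kernel twin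
"Lemma A" reads `3·SA ≥ Ntri`.

NEW (memo §2–3).  Lemma A is an IDENTITY (`3·SA = Ntri`) on every star-type composition `θ'∘(g₁,g₂,g₃)` and Lemma B on every product-type one;
and in the whole census (all 275,665,902 sunflowers on ≤ 5 points, and every structured / adversarial family tried up to 12 points) ONE of the two
lemmas always holds: `Ntri ≤ 3·max(SA, SB)`.  This dichotomy is recorded as the typed conjecture `PurePayer`; it implies `PartitionLemmaH`
(`partitionLemmaH_of_purePayer`), hence (tree: `hqt_of_partitionLemmaH`, `gammaRow_of_partitionLemmaH`) `H_{q+t}` and `GammaRow`.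
Its law-level shadow is `max(a,b)·(ab − e₂(c)) ≥ e₃(c)`.  `purePayer_iff_lemmaA_or_lemmaB` states it as "Lemma B can only fail where Lemma A holds".
-/

namespace Summit.CriticalPhenomena.PercolationContinuityZ3.Theorems.SunflowerPartition

open Finset

variable {α : Type*} [Fintype α] [DecidableEq α]

namespace Sunflower

variable (F : Sunflower α)

/-- Kernel-spectator Gladkov surplus `SA = Σ_{lab P¹ = ⊤} kk (lab P²) (lab P³)`. [this work] -/
def SA : ℤ := F.Sw (fun v => if v = 4 then 1 else 0)

/-- Bottom-spectator Gladkov surplus `SB = Σ_{lab P¹ = 0} kk (lab P²) (lab P³)`. [this work] -/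
def SB : ℤ := F.Sw (fun v => if v = 0 then 1 else 0)

/-- `SA ≥ 0` (antipodal Gladkov behind every kernel block). [this work] -/
theorem SA_nonneg : 0 ≤ F.SA :=
  F.Sw_nonneg _ fun v => by split_ifs <;> decide

/-- `SB ≥ 0` (antipodal Gladkov behind every bottom block). [this work] -/
theorem SB_nonneg : 0 ≤ F.SB :=
  F.Sw_nonneg _ fun v => by split_ifs <;> decide

/-- **`ZH = 3·(SA + SB) − Ntri`**: the `H`-row partition functional is three times the kernel- plus bottom-spectator Gladkov surplus minus the
ordered rainbow count. [this work] -/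
theorem ZH_eq_SA_SB : F.ZH = 3 * (F.SA + F.SB) - F.Ntri := by
  rw [F.ZH_eq_spec]
  unfold SA SB
  rw [← F.Sw_add]
  congr 3
  funext v
  revert v
  decide

/-- `ZA = 3·SA` (the tree's `ZA` is the kernel-spectator part of `ZH`). [this work] -/
theorem ZA_eq_three_mul_SA : F.ZA = 3 * F.SA := by
  unfold ZA SA Sw
  rw [mul_sum]
  refine sum_congr rfl fun q _ => ?_
  have h : ∀ x y z : Fin 5, vA x y z = 3 * ((if x = 4 then 1 else 0) * kk y z) := by decide
  exact h _ _ _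

/-- `ZB = 3·SB − Ntri` (so `PartitionLemmaB` is exactly "Lemma B": `Ntri ≤ 3·SB`). [this work] -/
theorem ZB_eq_three_mul_SB_sub : F.ZB = 3 * F.SB - F.Ntri := by
  have h := F.ZH_eq_ZA_add_ZB
  rw [F.ZH_eq_SA_SB, F.ZA_eq_three_mul_SA] at h
  linarith

end Sunflower

/-- **CONJECTURE `PurePayer`** (this work; OPEN; memo FINDING-PAYER-prove1-g29 §3): for every finite sunflower of up-sets the LARGER of the two
spectator surpluses alone pays for all rainbow partitions, `Ntri ≤ 3·max(SA, SB)`; i.e. Lemma A (`Ntri ≤ 3·SA`, an identity on star-type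
compositions) or Lemma B (`Ntri ≤ 3·SB`, an identity on product-type compositions) holds.  Census: exhaustive for `|α| ≤ 5` (275,665,902 maps) and
0 mixed instances in every family tried up to `|α| = 12`.  Strictly stronger than `PartitionLemmaH` (`partitionLemmaH_of_purePayer`).
An obligation, never a fact: use as `(h : PurePayer)`. [status: open] -/
@[conjecture] def PurePayer : Prop :=
  ∀ (α : Type) [Fintype α] [DecidableEq α] (F : Sunflower α), F.Ntri ≤ 3 * max F.SA F.SB

/-- **`PurePayer ⇒ PartitionLemmaH`**: `ZH = 3(SA+SB) − Ntri ≥ 3·max(SA,SB) − Ntri ≥ 0` since both surpluses are nonnegative. [this work] -/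
theorem partitionLemmaH_of_purePayer (h : PurePayer) : PartitionLemmaH := by
  intro α _ _ F
  have hP := h α F
  have hA := F.SA_nonneg
  have hB := F.SB_nonneg
  rw [F.ZH_eq_SA_SB]
  rcases le_total F.SA F.SB with hle | hle
  · rw [max_eq_right hle] at hP
    linarith
  · rw [max_eq_left hle] at hP
    linarith

/-- `PurePayer` in "Lemma A or Lemma B" form: for every sunflower, `Ntri ≤ ZA` (Lemma A) or `0 ≤ ZB` (Lemma B). [this work] -/
theorem purePayer_iff_lemmaA_or_lemmaB :
    PurePayer ↔ ∀ (α : Type) [Fintype α] [DecidableEq α] (F : Sunflower α), F.Ntri ≤ F.ZA ∨ 0 ≤ F.ZB := by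
  constructor
  · intro h α _ _ F
    have hP := h α F
    rw [F.ZA_eq_three_mul_SA, F.ZB_eq_three_mul_SB_sub]
    rcases le_total F.SA F.SB with hle | hle
    · rw [max_eq_right hle] at hP
      exact Or.inr (by linarith)
    · rw [max_eq_left hle] at hP
      exact Or.inl hP
  · intro h α _ _ F
    rcases h α F with hA | hB
    · rw [F.ZA_eq_three_mul_SA] at hA
      exact le_trans hA (by have := le_max_left F.SA F.SB; linarith)
    · rw [F.ZB_eq_three_mul_SB_sub] at hB
      have := le_max_right F.SA F.SB
      linarith

/-- `PurePayer ⇒ PartitionLemmaT` (the row `γ` needs). [this work] -/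
theorem partitionLemmaT_of_purePayer (h : PurePayer) : PartitionLemmaT :=
  partitionLemmaT_of_H (partitionLemmaH_of_purePayer h)

end Summit.CriticalPhenomena.PercolationContinuityZ3.Theorems.SunflowerPartition
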